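import Summits.Ventures.YMGap.FlowData.RectTubeTranslations
import Summits.Ventures.YMGap.FlowData.RectTubeVacuumSector
import HarnessLib

/-!
# Venture YMGap, track Y3 FLOW-DATA — TRANSLATION INVARIANCE of the rectangular tube transfer operator: `U_v ∘ T = T ∘ U_v`,
# `Π_ν ∘ T = T ∘ Π_ν`, the vacuum is translation invariant, and the momentum-π sector is orthogonal to it (theorems only)

HONEST FRAMING: venture file of the cell `pub-ymgap` (QuantumFields programme), track Y3; companion THEOREMS for the
definitions of `FlowData/RectTubeTranslations.lean` (the sanity facts announced there as a remark).  Finite rectangular torus,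
compact second-countable `G`, continuous `ρ`; no number, no row, nothing about `L → ∞`, the continuum or a mass gap.

* `rectElecSum_translate`, `rectSliceKernel_translate` — the slice kernel is translation invariant:
  `K(τ_v a, τ_v b) = K(a, b)` (plaquette and temporal sums re-indexed by `x ↦ x + v`, temporal links relabelled);
* **`rectTranslateOp_comp_rectTubeTransferOperator`** — `U_v ∘ T = T ∘ U_v`; **`rectMomentumPiOp_comp_rectTubeTransferOperator`**
  — `Π_ν ∘ T = T ∘ Π_ν`, so `T ∘ P_e ∘ Π_ν` is `T` composed with commuting averaging operators;
* `isStrictlyPositiveFun_rectTranslateOp`, **`rectTranslateOp_vacuum`** — the Jentzsch vacuum `φ₀` of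
  `RectTubeVacuumSector.exists_rectVacuum` is translation invariant (`U_v φ₀` is again a positive unit top eigenvector);
* **`rectMomentumPiOp_vacuum_eq_zero`** — for even `Ls ν ≥ 2`, `Π_ν φ₀ = 0`: the momentum-π sector is orthogonal to the vacuum
  (`Σ_j (−1)^j = 0`), so `E_{e,π_ν}` measures a genuine excitation.

References: M. Lüscher, Commun. Math. Phys. 54 (1977) 283 [cite: Luscher1977]; M. Reed, B. Simon IV (1978) §XIII.12
[cite: ReedSimonIV1978, §XIII.12]; G. 't Hooft, Nucl. Phys. B 153 (1979) 141 [cite: tHooft1979Flux].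
-/

noncomputable section

open scoped BigOperators ENNReal
open MeasureTheory Filter Function
open Literature.MathematicalPhysics.QuantumFieldTheory Literature.Analysis.OperatorTheory
open Literature.MathematicalPhysics.QuantumLattice (RectTorusSite)

namespace Summit.Ventures.YMGap.FlowData

/-! ### Translation invariance of the slice kernel -/

section Kernel

variable {G : Type*} [Group G] {n k : ℕ} (ρ : G →* Matrix (Fin n) (Fin n) ℂ) {Ls : Fin k → ℕ} [∀ i, NeZero (Ls i)]

/-- **The temporal plaquette sum is translation covariant**: translating both slices by `v` is undone by relabelling the
temporal links, `elec(τ_v a, E, τ_v b) = elec(a, E ∘ (· − v), b)`. [folklore] -/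
theorem rectElecSum_translate (v : RectTorusSite Ls) (a b : RectSlice Ls G) (E : RectTorusSite Ls → G) :
    rectElecSum ρ (rectTranslate v a) E (rectTranslate v b) = rectElecSum ρ a (fun x => E (x - v)) b := by
  unfold rectElecSum
  conv_rhs => rw [← Equiv.sum_comp (Equiv.addRight v)]
  refine Finset.sum_congr rfl fun x _ => Finset.sum_congr rfl fun i _ => ?_
  simp only [rectTranslate_apply, Equiv.coe_addRight, add_sub_cancel_right, add_right_comm x v, add_sub_cancel_right]

variable [TopologicalSpace G] [IsTopologicalGroup G] [CompactSpace G] [MeasurableSpace G] [BorelSpace G]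

/-- Relabelling the temporal links `E ↦ E ∘ (· − v)` preserves their product Haar measure. [folklore] -/
theorem integral_comp_sub_site (v : RectTorusSite Ls) (g : (RectTorusSite Ls → G) → ℝ) :
    ∫ E, g (fun x : RectTorusSite Ls => E (x - v)) ∂(Measure.pi fun _ : RectTorusSite Ls => haarProbability G) =
      ∫ E, g E ∂(Measure.pi fun _ : RectTorusSite Ls => haarProbability G) := by
  have h := (measurePreserving_piCongrLeft (fun _ : RectTorusSite Ls => haarProbability G)
    (Equiv.addRight v)).integral_comp' (g := g)
  have he : ∀ E : RectTorusSite Ls → G,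
      (MeasurableEquiv.piCongrLeft (fun _ : RectTorusSite Ls => G) (Equiv.addRight v)) E =
        fun x : RectTorusSite Ls => E (x - v) := by
    intro E
    funext x
    simp only [MeasurableEquiv.coe_piCongrLeft, Equiv.piCongrLeft_apply_eq_cast, cast_eq, Equiv.addRight_symm,
      Equiv.coe_addRight, sub_eq_add_neg]
  simp_rw [he] at h
  exact h

/-- **The rectangular slice kernel is translation invariant**: `K(τ_v a, τ_v b) = K(a, b)`. [cite: Luscher1977] -/
theorem rectSliceKernel_translate (JE JM : ℝ) (v : RectTorusSite Ls) (a b : RectSlice Ls G) :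
    rectSliceKernel ρ JE JM (rectTranslate v a) (rectTranslate v b) = rectSliceKernel ρ JE JM a b := by
  -- spatial plaquettes: re-index the site sum
  have hmag : ∀ c : RectSlice Ls G, rectMagSum ρ (rectTranslate v c) = rectMagSum ρ c := by
    intro c
    unfold rectMagSum
    conv_rhs => rw [← Equiv.sum_comp (Equiv.addRight v)]
    refine Finset.sum_congr rfl fun x _ => Finset.sum_congr rfl fun p _ => ?_
    simp only [rectTranslate_apply, Equiv.coe_addRight, add_right_comm x v]
  unfold rectSliceKernel
  rw [hmag, hmag]
  congr 2
  simp_rw [rectElecSum_translate ρ v a b]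
  exact integral_comp_sub_site v (fun E => Real.exp (JE * rectElecSum ρ a E b))

end Kernel

/-! ### `U_v` and `Π_ν` commute with the transfer operator -/

section Commute

variable {G : Type*} [Group G] [TopologicalSpace G] [IsTopologicalGroup G] [CompactSpace G]
  [MeasurableSpace G] [BorelSpace G] [SecondCountableTopology G] {n : ℕ} (ρ : G →* Matrix (Fin n) (Fin n) ℂ)
  (J : ℝ) {k : ℕ} {Ls : Fin k → ℕ} [∀ i, NeZero (Ls i)]

/-- **Translations commute with the transfer operator**: `U_v ∘ T = T ∘ U_v` (both sides have the kernel
`(a, b) ↦ K(τ_v a, b)`: translation invariance of `K` and the change of variables `b ↦ τ_v b`). [cite: Luscher1977] -/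
theorem rectTranslateOp_comp_rectTubeTransferOperator (hρ : Continuous ρ) (v : RectTorusSite Ls) :
    (rectTranslateOp Ls v).comp (rectTubeTransferOperator ρ J Ls) =
      (rectTubeTransferOperator ρ J Ls).comp (rectTranslateOp Ls v) := by
  set μ : Measure (RectSlice Ls G) := rectSliceMeasure G Ls with hμ
  set K : RectSlice Ls G → RectSlice Ls G → ℝ := rectSliceKernel ρ J J with hK
  have hmp : MeasurePreserving (rectTranslate (G := G) (Ls := Ls) v) μ μ := measurePreserving_rectTranslate v
  have hKc : Continuous (uncurry K) := continuous_rectSliceKernel ρ hρ J J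
  refine ContinuousLinearMap.ext fun φ => Lp.ext ?_
  rw [ContinuousLinearMap.comp_apply, ContinuousLinearMap.comp_apply]
  have hL : (rectTranslateOp Ls v (rectTubeTransferOperator ρ J Ls φ) : RectSlice Ls G → ℝ) =ᵐ[μ]
      fun a => ∫ b, K (rectTranslate v a) b * φ b ∂μ := by
    refine (rectTranslateOp_ae_eq v _).trans ?_
    exact hmp.quasiMeasurePreserving.ae_eq_comp (rectTubeTransferOperator_ae_eq J Ls hρ φ)
  have hR : (rectTubeTransferOperator ρ J Ls (rectTranslateOp Ls v φ) : RectSlice Ls G → ℝ) =ᵐ[μ]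
      fun a => ∫ b, K (rectTranslate v a) b * φ b ∂μ := by
    refine (rectTubeTransferOperator_ae_eq J Ls hρ _).trans (Eventually.of_forall fun a => ?_)
    have hcs := rectTranslateOp_ae_eq (Ls := Ls) v φ
    have h1 : ∫ b, K a b * (rectTranslateOp Ls v φ : RectSlice Ls G → ℝ) b ∂μ =
        ∫ b, K a b * φ (rectTranslate v b) ∂μ := by
      refine integral_congr_ae ?_
      filter_upwards [hcs] with b hb
      rw [hb, Function.comp_apply]
    have h2 : ∫ b, K a b * φ (rectTranslate v b) ∂μ =
        ∫ b, (fun c => K (rectTranslate v a) c * φ c) (rectTranslate v b) ∂μ := by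
      refine integral_congr_ae (Eventually.of_forall fun b => ?_)
      simp only [hK, rectSliceKernel_translate ρ J J v]
    have hg : AEStronglyMeasurable (fun c => K (rectTranslate v a) c * φ c) μ :=
      ((hKc.comp (Continuous.prodMk continuous_const continuous_id)).aestronglyMeasurable).mul
        (Lp.aestronglyMeasurable φ)
    have h3 : ∫ b, (fun c => K (rectTranslate v a) c * φ c) (rectTranslate v b) ∂μ =
        ∫ c, K (rectTranslate v a) c * φ c ∂μ := by
      have hg' : AEStronglyMeasurable (fun c => K (rectTranslate v a) c * φ c)
          (Measure.map (rectTranslate (G := G) (Ls := Ls) v) μ) := by rw [hmp.map_eq]; exact hg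
      have := integral_map hmp.measurable.aemeasurable hg'
      rw [hmp.map_eq] at this
      exact this.symm
    dsimp only
    rw [h1, h2, h3]
  exact hL.trans hR.symm

/-- **The momentum-π averaging commutes with the transfer operator**: `Π_ν ∘ T = T ∘ Π_ν`. [cite: Luscher1977] -/
theorem rectMomentumPiOp_comp_rectTubeTransferOperator (hρ : Continuous ρ) (ν : Fin k) :
    (rectMomentumPiOp (G := G) Ls ν).comp (rectTubeTransferOperator ρ J Ls) =
      (rectTubeTransferOperator ρ J Ls).comp (rectMomentumPiOp Ls ν) := by
  unfold rectMomentumPiOp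
  rw [ContinuousLinearMap.smul_comp, ContinuousLinearMap.comp_smul, ContinuousLinearMap.finsetSum_comp,
    ContinuousLinearMap.comp_finsetSum]
  congr 1
  refine Finset.sum_congr rfl fun j _ => ?_
  rw [ContinuousLinearMap.smul_comp, ContinuousLinearMap.comp_smul,
    rectTranslateOp_comp_rectTubeTransferOperator ρ J hρ]

end Commute

/-! ### The vacuum is translation invariant; the momentum-π sector is orthogonal to it -/

section Vacuum

variable {G : Type*} [Group G] [TopologicalSpace G] [IsTopologicalGroup G] [CompactSpace G]
  [MeasurableSpace G] [BorelSpace G] [SecondCountableTopology G] {n : ℕ} (ρ : G →* Matrix (Fin n) (Fin n) ℂ)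
  (J : ℝ) {k : ℕ} {Ls : Fin k → ℕ} [∀ i, NeZero (Ls i)]

omit [SecondCountableTopology G] in
/-- A translate of an a.e. strictly positive function is a.e. strictly positive. [folklore] -/
theorem isStrictlyPositiveFun_rectTranslateOp (v : RectTorusSite Ls) {φ : Lp ℝ 2 (rectSliceMeasure G Ls)}
    (hφ : IsStrictlyPositiveFun φ) : IsStrictlyPositiveFun (rectTranslateOp Ls v φ) := by
  unfold IsStrictlyPositiveFun at hφ ⊢
  have h1 := (measurePreserving_rectTranslate (G := G) (Ls := Ls) v).quasiMeasurePreserving.ae hφ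
  filter_upwards [rectTranslateOp_ae_eq v φ, h1] with a ha hpos
  rw [ha, Function.comp_apply]
  exact hpos

/-- **The vacuum is translation invariant**: for the positive unit top eigenvector `φ₀` of `T` (simple top eigenvalue,
`RectTubeVacuumSector.exists_rectVacuum`), `U_v φ₀ = φ₀` for every `v` — `U_v φ₀` is again a positive unit top
eigenvector, hence `c φ₀` with `|c| = 1`, `c > 0`. [cite: ReedSimonIV1978, §XIII.12] -/
theorem rectTranslateOp_vacuum (hρ : Continuous ρ) {φ₀ : Lp ℝ 2 (rectSliceMeasure G Ls)} (h1 : ‖φ₀‖ = 1)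
    (hpos : IsStrictlyPositiveFun φ₀)
    (heig : rectTubeTransferOperator ρ J Ls φ₀ = ‖rectTubeTransferOperator ρ J Ls‖ • φ₀)
    (hsimple : ∀ η, rectTubeTransferOperator ρ J Ls η = ‖rectTubeTransferOperator ρ J Ls‖ • η →
      η = (@inner ℝ _ _ φ₀ η) • φ₀)
    (v : RectTorusSite Ls) : rectTranslateOp Ls v φ₀ = φ₀ := by
  set T := rectTubeTransferOperator ρ J Ls with hT
  have hcomm : T (rectTranslateOp Ls v φ₀) = rectTranslateOp Ls v (T φ₀) := by
    have h := congrArg (fun A => A φ₀) (rectTranslateOp_comp_rectTubeTransferOperator ρ J hρ v (Ls := Ls))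
    simpa only [ContinuousLinearMap.comp_apply] using h.symm
  have heig' : T (rectTranslateOp Ls v φ₀) = ‖T‖ • rectTranslateOp Ls v φ₀ := by
    rw [hcomm, heig, map_smul]
  set c : ℝ := @inner ℝ _ _ φ₀ (rectTranslateOp Ls v φ₀) with hc
  have hcφ : rectTranslateOp Ls v φ₀ = c • φ₀ := hsimple _ heig'
  have habs : |c| = 1 := by
    have h := norm_rectTranslateOp_apply (Ls := Ls) v φ₀
    rw [hcφ, norm_smul, Real.norm_eq_abs, h1, mul_one] at h
    exact h
  have hcpos : 0 < c := by
    have hsp := isStrictlyPositiveFun_rectTranslateOp (Ls := Ls) v hpos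
    unfold IsStrictlyPositiveFun at hsp hpos
    rw [hcφ] at hsp
    have hae : ∀ᵐ a ∂(rectSliceMeasure G Ls), 0 < c := by
      filter_upwards [hsp, hpos, Lp.coeFn_smul c φ₀] with a ha hφa hsm
      rw [hsm, Pi.smul_apply, smul_eq_mul] at ha
      exact pos_of_mul_pos_left ha hφa.le
    haveI : (ae (rectSliceMeasure G Ls)).NeBot := ae_neBot.2 (IsProbabilityMeasure.ne_zero _)
    exact hae.exists.choose_spec
  have hc1 : c = 1 := by
    rw [abs_of_pos hcpos] at habs
    exact habs
  rw [hcφ, hc1, one_smul]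

omit [SecondCountableTopology G] in
/-- **The momentum-π sector is orthogonal to the vacuum**: for a translation-invariant `φ` and even `Ls ν ≥ 2`,
`Π_ν φ = (Ls ν)⁻¹ (Σ_j (−1)^j) φ = 0`. [folklore] -/
theorem rectMomentumPiOp_apply_of_translate_invariant (ν : Fin k) (hν : Even (Ls ν)) (h2 : 2 ≤ Ls ν)
    {φ : Lp ℝ 2 (rectSliceMeasure G Ls)} (hφ : ∀ v : RectTorusSite Ls, rectTranslateOp Ls v φ = φ) :
    rectMomentumPiOp Ls ν φ = 0 := by
  unfold rectMomentumPiOp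
  rw [_root_.smul_apply, _root_.sum_apply]
  simp_rw [_root_.smul_apply, hφ, ← Finset.sum_smul]
  have hsum : ∑ j : ZMod (Ls ν), zmodParitySign j = 0 := by
    haveI : Fact (1 < Ls ν) := ⟨h2⟩
    have h1 : zmodParitySign (1 : ZMod (Ls ν)) = -1 := by
      rw [zmodParitySign, ZMod.val_one, pow_one]
    have h : ∑ j : ZMod (Ls ν), zmodParitySign j = ∑ j : ZMod (Ls ν), zmodParitySign (j + 1) :=
      (Equiv.sum_comp (Equiv.addRight (1 : ZMod (Ls ν))) (fun j => zmodParitySign j)).symm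
    have h' : ∑ j : ZMod (Ls ν), zmodParitySign (j + 1) = -∑ j : ZMod (Ls ν), zmodParitySign j := by
      rw [← Finset.sum_neg_distrib]
      refine Finset.sum_congr rfl fun j _ => ?_
      rw [zmodParitySign_add hν, h1, mul_neg_one]
    linarith [h.trans h']
  rw [hsum, zero_smul, smul_zero]

/-- **The Jentzsch vacuum of the rectangular tube has momentum zero and no momentum-π component**: there is a unit,
a.e. strictly positive top eigenvector `φ₀` with `U_v φ₀ = φ₀` for all `v` and `Π_ν φ₀ = 0` for every axis `ν` with
`Ls ν` even (continuous unitary `ρ`, central `z` as in `exists_rectVacuum`). [cite: ReedSimonIV1978, §XIII.12] -/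
theorem exists_rectVacuum_translate (hρ : Continuous ρ) (hρu : ∀ g, ρ g ∈ Matrix.unitaryGroup (Fin n) ℂ) {z : G}
    (hz : z ∈ Subgroup.center G) :
    ∃ φ₀ : Lp ℝ 2 (rectSliceMeasure G Ls), ‖φ₀‖ = 1 ∧ IsStrictlyPositiveFun φ₀ ∧
      rectTubeTransferOperator ρ J Ls φ₀ = ‖rectTubeTransferOperator ρ J Ls‖ • φ₀ ∧
      (∀ s : Fin k → ZMod 2, rectFluxTwistOp Ls z s φ₀ = φ₀) ∧
      (∀ v : RectTorusSite Ls, rectTranslateOp Ls v φ₀ = φ₀) ∧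
      ∀ ν : Fin k, Even (Ls ν) → rectMomentumPiOp Ls ν φ₀ = 0 := by
  obtain ⟨φ₀, h1, hpos, heig, hsimple, hinv⟩ := exists_rectVacuum ρ J hρ hρu hz (Ls := Ls)
  have htr : ∀ v : RectTorusSite Ls, rectTranslateOp Ls v φ₀ = φ₀ := fun v =>
    rectTranslateOp_vacuum ρ J hρ h1 hpos heig hsimple v
  refine ⟨φ₀, h1, hpos, heig, hinv, htr, fun ν hν => ?_⟩
  have h2 : 2 ≤ Ls ν := by
    obtain ⟨r, hr⟩ := hν
    have h0 : Ls ν ≠ 0 := NeZero.ne _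
    omega
  exact rectMomentumPiOp_apply_of_translate_invariant ν hν h2 htr

end Vacuum

end Summit.Ventures.YMGap.FlowData
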